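import Summits.QuantumFields.YangMills.Theorems.ParabolicTrajectoryTunedSequenceExistsRPDiagonalVariant
import Summits.QuantumFields.YangMills.Theorems.LangevinControlUVFemtoCurvatureTwoPointCDefs
import Literature.MathematicalPhysics.QuantumFieldTheory.LatticeGaugeStaticPotentialProofs

/-!
# Crux `TunedSequenceExists` (stmt-QuantumFields-10524) vs the sibling crux `FemtoCurvatureTwoPointC`
# (stmt-QuantumFields-16204): vocabulary, the Q-CHANNEL BRIDGE, and the forced vanishing `Γ(0+) = 0`
# (lead c5 of line `fixed-aspect-window`, `--supports stmt-QuantumFields-10524`)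

## Part 1 — vocabulary (route-posited statements and predicates; NOTHING in Part 1 is asserted)

* `CruxCAtWith r a Γ β₀ ℓ₀ c C` — the body of the sibling crux `FemtoCurvatureTwoPointC.CruxCAt r` at GIVEN data
  (unit map `a`, shape `Γ`, threshold `β₀`, femto radius `ℓ₀`, constants `c, C`), verbatim;
  `cruxCAt_iff_exists_with : CruxCAt r ↔ ∃ a, Continuous a ∧ ∃ Γ β₀ ℓ₀ c C, CruxCAtWith r a Γ β₀ ℓ₀ c C` is `Iff.rfl`.
  Needed because the theorems of this package speak about the SAME `a, Γ, ℓ₀` across several conclusions.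
* `axisCycle` — the permutation `(0 1 2)` of the four coordinate axes that carries the sibling's axis channel
  (plane `(0,1)`, displacement `e₂`) onto the time-axis autocorrelation of the time-zero plaquette
  `Q = spatialPlaquette r` (plane `(1,2)`, displacement `e₀`) of `…RPDiagonalVariant`.
* `FemtoLowerBoundQ r M` — (U_Q,∃h): the pinned-aspect window for `Q` with an EXISTENTIAL positive height `h(L₁)`
  (weaker than `RPDiagonalVariant.FemtoWindowQ`, whose height is `c / log² L₁`); this is the form the sibling crux
  delivers (`…QFemtoReduction`).
* `VolumeMonotoneQRel r M`, `VolumeMonotoneQRelAll` — (V_Q,rel): one-sided volume quasi-monotonicity of the rescaled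
  `Q`-correlator in RELATIVE (constant-factor) form: enlarging the torus beyond aspect `L₁` costs at most a factor `K`,
  uniformly at weak coupling and large depth. The ONE new child of the `Q`-restated crux once the sibling crux is
  granted (`…QFemtoReduction`: `FemtoCurvatureTwoPointC → VolumeMonotoneQRelAll → TunedSequenceExistsQ`). A
  thermodynamic-limit statement at weak coupling (the tori it compares are NOT femto); inhabited by the zero table, so
  not ≥ the crux core; physically a finite-size effect of relative order `L₁⁻⁴`.

## Part 2 — the bridge and `Γ(0+) = 0` (theorems)

* `latticeConnectedCorr_spatialPlaquette_eq_axisCov` — the crux-format connected correlator of the time-zero plaquette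
  `Q = Re tr r(U_{p₁₂(0)})` along the time axis, `⟨Q ; τ_n Q⟩_{β, S}`, IS the sibling's axis channel
  `cov_{β,S}(P^{01}_0, P^{01}_{n e₂})` of plaquette DEFICITS `P = N − Re tr` (axis permutation `(0 1 2)` of the symmetric
  torus, `wilsonExpectation_comp_configPerm`; the deficit and `Re tr` have the same covariance).
* `axis_window_of_cruxCAtWith` — hence clause 1 of the sibling crux, read in crux format: on every femto torus
  `c·Γ(n·a β) ≤ n⁸ ⟨Q;τ_nQ⟩_{β,S} ≤ C·Γ(n·a β)` (`β ≥ β₀`, `S·a β ≤ ℓ₀`, `1 ≤ n`, `8n ≤ S`).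
* `exists_ge_unitMap_eq` — a continuous positive unit map `a → 0` takes every small value beyond every floor (IVT).
* `gamma_tendsto_zero_of_cruxCAtWith` — **the sibling's shape is forced to vanish at `0+`**: `Γ(s) → 0` as `s → 0+`
  (freezing of `⟨Q;τ_1Q⟩_{β,8}` as `β → ∞` on the fixed torus of side 8, transported along `s = a(β)` by the IVT).
  This is the formal reason why every tuned witness of the crux lives on NON-femto tori (sequel files `…QNonFemto`,
  `…PNonFemto`): the thermodynamic-limit child is necessary, not an artefact of the split.

References: Osterwalder–Seiler 1978 §2 (torus Wilson states, lattice symmetries); the sibling crux's own dissection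
`Cruxes/FemtoCurvatureTwoPoint/Disproof.lean` § Repairs (why continuity of the unit map is load-bearing).
-/
noncomputable section

open Filter Topology MeasureTheory
open Literature.MathematicalPhysics.QuantumFieldTheory Literature.MathematicalPhysics.QuantumLattice

namespace Summit.QuantumFields.YangMills.Theorems.TunedSequenceExists.QFemto

open RPDiagonalVariant (spatialPlaquette)

variable {G : Type} [Group G] [TopologicalSpace G] [IsTopologicalGroup G] [CompactSpace G]
  [MeasurableSpace G] [BorelSpace G]

/-- **The sibling crux body at given data.** Verbatim the body of `FemtoCurvatureTwoPointC.CruxCAt r` after its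
existential prefix `∃ a, Continuous a ∧ ∃ Γ β₀ ℓ₀ c C`: positivity of the unit map `a`, `a → 0`, the shape
`Γ ∈ (0, 1]` on `(0, ℓ₀]`, and on every femto torus (`β ≥ β₀`, `L · a β ≤ ℓ₀`) the two-sided axis window for
`n⁸ · cov(P^{01}_0, P^{01}_{n e₂})` (`1 ≤ n`, `8 n ≤ L`) and the all-pairs ceiling. A hypothesis SHAPE with
parameters; not a fact. -/
def CruxCAtWith (r : LatticeRep G) (a Γ : ℝ → ℝ) (β₀ ℓ₀ c C : ℝ) : Prop :=
  0 < ℓ₀ ∧ 0 < c ∧ (∀ β, 0 < a β) ∧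
    Filter.Tendsto a Filter.atTop (nhds 0) ∧ (∀ s : ℝ, 0 < s → s ≤ ℓ₀ → 0 < Γ s ∧ Γ s ≤ 1) ∧
    ∀ (L : ℕ) [NeZero L] (β : ℝ), β₀ ≤ β → (L : ℝ) * a β ≤ ℓ₀ →
      let P : (Fin 4 → ZMod L) → Fin 4 → Fin 4 → GaugeConfig 4 L G → ℝ :=
        fun x i j U => (r.N : ℝ) - (r.ρ (plaquetteHolonomy U x i j)).trace.re
      let E : (GaugeConfig 4 L G → ℝ) → ℝ := fun F => wilsonExpectation (d := 4) (L := L) r.ρ β F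
      let cov : (GaugeConfig 4 L G → ℝ) → (GaugeConfig 4 L G → ℝ) → ℝ :=
        fun F F' => E (fun U => F U * F' U) - E F * E F'
      let dist : (Fin 4 → ZMod L) → (Fin 4 → ZMod L) → ℝ :=
        fun x y => Real.sqrt (∑ k : Fin 4, (((x k - y k).valMinAbs : ℤ) : ℝ) ^ 2)
      (∀ n : ℕ, 1 ≤ n → 8 * n ≤ L →
          c * Γ ((n : ℝ) * a β) ≤ (n : ℝ) ^ 8 * cov (P 0 0 1) (P (Pi.single (2 : Fin 4) ((n : ℕ) : ZMod L)) 0 1) ∧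
          (n : ℝ) ^ 8 * cov (P 0 0 1) (P (Pi.single (2 : Fin 4) ((n : ℕ) : ZMod L)) 0 1) ≤ C * Γ ((n : ℝ) * a β)) ∧
      (∀ (x y : Fin 4 → ZMod L) (i j i' j' : Fin 4), x ≠ y → i ≠ j → i' ≠ j' →
          |cov (P x i j) (P y i' j')| * dist x y ^ 8 ≤ C * Γ (dist x y * a β))

/-- Definitional unbundling: `CruxCAt r ↔ ∃ a, Continuous a ∧ ∃ Γ β₀ ℓ₀ c C, CruxCAtWith r a Γ β₀ ℓ₀ c C`. -/
theorem cruxCAt_iff_exists_with (r : LatticeRep G) :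
    FemtoCurvatureTwoPointC.CruxCAt r ↔
      ∃ a : ℝ → ℝ, Continuous a ∧ ∃ (Γ : ℝ → ℝ) (β₀ ℓ₀ c C : ℝ), CruxCAtWith r a Γ β₀ ℓ₀ c C :=
  Iff.rfl

/-- **The axis permutation `(0 1 2)`** of the four coordinate directions: `0 ↦ 1 ↦ 2 ↦ 0`, `3 ↦ 3`. -/
def axisCycle : Equiv.Perm (Fin 4) := Equiv.swap 0 2 * Equiv.swap 0 1

/-- `axisCycle⁻¹ 0 = 2`. -/
@[simp] theorem axisCycle_symm_zero : axisCycle.symm 0 = 2 := by decide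

/-- `axisCycle⁻¹ 1 = 0`. -/
@[simp] theorem axisCycle_symm_one : axisCycle.symm 1 = 0 := by decide

/-- `axisCycle⁻¹ 2 = 1`. -/
@[simp] theorem axisCycle_symm_two : axisCycle.symm 2 = 1 := by decide

/-- **(U_Q,∃h) — the pinned-aspect window for `Q` with an existential positive height.** For every aspect `L₁ ≥ LU`
there is `h > 0` such that beyond every coupling floor `B` and depth floor `m₀` some `(m, β)` has
`h ≤ (M^m)⁸ ⟨Q ; τ_{M^m} Q⟩_{β, 2 L₁ M^m + 1}`. -/
def FemtoLowerBoundQ (r : LatticeRep G) (M : ℕ) : Prop :=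
  ∃ LU : ℕ, ∀ L₁ : ℕ, LU ≤ L₁ → ∃ h : ℝ, 0 < h ∧ ∀ (B : ℝ) (m₀ : ℕ),
    ∃ m : ℕ, m₀ ≤ m ∧ ∃ β : ℝ, B ≤ β ∧
      h ≤ ((M : ℝ) ^ m) ^ 8 *
        latticeConnectedCorr r.ρ β (2 * (L₁ * M ^ m) + 1) (spatialPlaquette r) (spatialPlaquette r) (M ^ m)

/-- **(V_Q,rel) — relative volume quasi-monotonicity for `Q`.** There is a factor `K > 0` and an aspect floor `LV`
such that for every aspect `L₁ ≥ LV` there are `β₁, m₁` with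
`(M^m)⁸ ⟨Q;τ_{M^m}Q⟩_{β, 2L₁M^m+1} ≤ K · (M^m)⁸ ⟨Q;τ_{M^m}Q⟩_{β, 2L+1}` for all `β ≥ β₁`, `m ≥ m₁`, `L ≥ L₁ M^m`
(enlarging the torus beyond aspect `L₁` costs at most the factor `K`). -/
def VolumeMonotoneQRel (r : LatticeRep G) (M : ℕ) : Prop :=
  ∃ K : ℝ, 0 < K ∧ ∃ LV : ℕ, ∀ L₁ : ℕ, LV ≤ L₁ → ∃ (β₁ : ℝ) (m₁ : ℕ),
    ∀ (β : ℝ) (m L : ℕ), β₁ ≤ β → m₁ ≤ m → L₁ * M ^ m ≤ L →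
      ((M : ℝ) ^ m) ^ 8 *
          latticeConnectedCorr r.ρ β (2 * (L₁ * M ^ m) + 1) (spatialPlaquette r) (spatialPlaquette r) (M ^ m) ≤
        K * (((M : ℝ) ^ m) ^ 8 *
          latticeConnectedCorr r.ρ β (2 * L + 1) (spatialPlaquette r) (spatialPlaquette r) (M ^ m))

/-- (V_Q,rel) under the crux prefix (every compact simple `G`, Borel structure `borel G`, every `r`, every `M ≥ 2`). -/
def VolumeMonotoneQRelAll : Prop :=
  ∀ (G : Type) [Group G] [TopologicalSpace G] [IsTopologicalGroup G] [CompactSpace G],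
    IsCompactSimpleLieGroup G → letI : MeasurableSpace G := borel G
    haveI : BorelSpace G := ⟨rfl⟩
    ∀ (r : LatticeRep G) (M : ℕ), 2 ≤ M → VolumeMonotoneQRel r M

/-- The zero table inhabits the SHAPE of (V_Q,rel) (so (V_Q,rel) alone is not ≥ the crux core, whose shape the zero
table fails, `FixedAspectSplit.not_lowerBoundShape_zero`). -/
theorem volumeMonotoneQRelShape_zero (M : ℕ) :
    ∃ K : ℝ, 0 < K ∧ ∃ LV : ℕ, ∀ L₁ : ℕ, LV ≤ L₁ → ∃ (β₁ : ℝ) (m₁ : ℕ),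
      ∀ (β : ℝ) (m L : ℕ), β₁ ≤ β → m₁ ≤ m → L₁ * M ^ m ≤ L →
        ((M : ℝ) ^ m) ^ 8 * (fun (_ : ℝ) (_ _ : ℕ) => (0 : ℝ)) β (L₁ * M ^ m) (M ^ m) ≤
          K * (((M : ℝ) ^ m) ^ 8 * (fun (_ : ℝ) (_ _ : ℕ) => (0 : ℝ)) β L (M ^ m)) :=
  ⟨1, one_pos, 0, fun _ _ => ⟨0, 0, fun _ _ _ _ _ _ => by simp⟩⟩

/-! # Part 2 — the Q-channel bridge and `Γ(0+) = 0` -/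

open ProbabilityTheory
open RPDiagonalVariant (q12 latticeConnectedCorr_spatialPlaquette_eq
  latticeConnectedCorr_spatialPlaquette_tendsto_zero latticeConnectedCorr_spatialPlaquette_nonneg)
open Negative.Freezing (secondCountable_of_latticeRep continuous_plaquetteHolonomy)

/-! ## The axis permutation carries the `(1,2)`-plaquettes along `e₀` onto the `(0,1)`-plaquettes along `e₂` -/

omit [IsTopologicalGroup G] [CompactSpace G] [BorelSpace G] in
/-- `sitePerm axisCycle.symm` fixes the origin. -/
theorem sitePerm_axisCycle_symm_zero (S : ℕ) : sitePerm axisCycle.symm (0 : Site 4 S) = 0 := by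
  funext j; simp

omit [IsTopologicalGroup G] [CompactSpace G] [BorelSpace G] in
/-- `sitePerm axisCycle.symm (n e₀) = n e₂`. -/
theorem sitePerm_axisCycle_symm_single (S : ℕ) (n : ℕ) :
    sitePerm axisCycle.symm (Pi.single (0 : Fin 4) ((n : ℕ) : ZMod S) : Site 4 S) =
      Pi.single (2 : Fin 4) ((n : ℕ) : ZMod S) := by
  rw [sitePerm_single, axisCycle_symm_zero]

omit [IsTopologicalGroup G] [CompactSpace G] [BorelSpace G] in
/-- The `(1,2)` plaquette function at `x`, read on the axis-permuted configuration, is the `(0,1)` plaquette function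
at `sitePerm axisCycle.symm x`. -/
theorem plaqRe_q12_configPerm (r : LatticeRep G) (S : ℕ) (U : GaugeConfig 4 S G) (x : Site 4 S) :
    WilsonRP.plaqRe r.ρ (configPerm axisCycle U) (x, q12) =
      (r.ρ (plaquetteHolonomy U (sitePerm axisCycle.symm x) 0 1)).trace.re := by
  simp only [WilsonRP.plaqRe, q12, plaquetteHolonomy_configPerm, axisCycle_symm_one, axisCycle_symm_two]

omit [CompactSpace G] [MeasurableSpace G] [BorelSpace G] in
/-- The torus plaquette function `U ↦ Re tr r(U_{∂p(x;i,j)})` is continuous. -/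
theorem continuous_reTr_plaquetteHolonomy (r : LatticeRep G) (S : ℕ) (x : Site 4 S) (i j : Fin 4) :
    Continuous fun U : GaugeConfig 4 S G => (r.ρ (plaquetteHolonomy U x i j)).trace.re :=
  (continuous_trace_re r.ρ r.continuous).comp (continuous_plaquetteHolonomy _ _ _)

/-- The torus plaquette functions are in `L²` of the Wilson state (continuous on a compact configuration space,
probability measure). -/
theorem memLp_reTr_plaquetteHolonomy (r : LatticeRep G) (β : ℝ) (S : ℕ) [NeZero S] (x : Site 4 S)
    (i j : Fin 4) :
    MemLp (fun U : GaugeConfig 4 S G => (r.ρ (plaquetteHolonomy U x i j)).trace.re) 2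
      (wilsonMeasure (d := 4) (L := S) r.ρ β) := by
  haveI : SecondCountableTopology G := secondCountable_of_latticeRep r
  haveI := isProbabilityMeasure_wilsonMeasure (d := 4) (L := S) r.ρ r.continuous β
  have hcont := continuous_reTr_plaquetteHolonomy r S x i j
  obtain ⟨K, hK⟩ := (isCompact_univ.image (continuous_abs.comp hcont)).isBounded.bddAbove
  exact MemLp.of_bound hcont.aestronglyMeasurable K
    (ae_of_all _ fun U => by
      rw [Real.norm_eq_abs]; exact hK ⟨U, Set.mem_univ _, rfl⟩)

/-- The deficit `N − Re tr` has the same covariance as `Re tr` (in the `E[XY] − E[X]E[Y]` format of the sibling crux). -/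
theorem deficitCov_eq (r : LatticeRep G) (β : ℝ) (S : ℕ) [NeZero S] (x y : Site 4 S) (i j i' j' : Fin 4) :
    wilsonExpectation (d := 4) (L := S) r.ρ β (fun U =>
        ((r.N : ℝ) - (r.ρ (plaquetteHolonomy U x i j)).trace.re) *
          ((r.N : ℝ) - (r.ρ (plaquetteHolonomy U y i' j')).trace.re)) -
      wilsonExpectation (d := 4) (L := S) r.ρ β (fun U => (r.N : ℝ) - (r.ρ (plaquetteHolonomy U x i j)).trace.re) *
        wilsonExpectation (d := 4) (L := S) r.ρ β (fun U =>
          (r.N : ℝ) - (r.ρ (plaquetteHolonomy U y i' j')).trace.re) =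
    wilsonExpectation (d := 4) (L := S) r.ρ β (fun U =>
        (r.ρ (plaquetteHolonomy U x i j)).trace.re * (r.ρ (plaquetteHolonomy U y i' j')).trace.re) -
      wilsonExpectation (d := 4) (L := S) r.ρ β (fun U => (r.ρ (plaquetteHolonomy U x i j)).trace.re) *
        wilsonExpectation (d := 4) (L := S) r.ρ β (fun U => (r.ρ (plaquetteHolonomy U y i' j')).trace.re) := by
  haveI := isProbabilityMeasure_wilsonMeasure (d := 4) (L := S) r.ρ r.continuous β
  have hA := memLp_reTr_plaquetteHolonomy r β S x i j
  have hB := memLp_reTr_plaquetteHolonomy r β S y i' j'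
  have hA' : MemLp (fun U : GaugeConfig 4 S G => (r.N : ℝ) - (r.ρ (plaquetteHolonomy U x i j)).trace.re) 2
      (wilsonMeasure (d := 4) (L := S) r.ρ β) := (memLp_const _).sub hA
  have hB' : MemLp (fun U : GaugeConfig 4 S G => (r.N : ℝ) - (r.ρ (plaquetteHolonomy U y i' j')).trace.re) 2
      (wilsonMeasure (d := 4) (L := S) r.ρ β) := (memLp_const _).sub hB
  have hcov : cov[fun U : GaugeConfig 4 S G => (r.ρ (plaquetteHolonomy U x i j)).trace.re,
      fun U => (r.ρ (plaquetteHolonomy U y i' j')).trace.re; wilsonMeasure (d := 4) (L := S) r.ρ β] =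
      cov[fun U : GaugeConfig 4 S G => (r.N : ℝ) - (r.ρ (plaquetteHolonomy U x i j)).trace.re,
      fun U => (r.N : ℝ) - (r.ρ (plaquetteHolonomy U y i' j')).trace.re; wilsonMeasure (d := 4) (L := S) r.ρ β] := by
    rw [covariance_const_sub_left (hA.integrable one_le_two),
      covariance_const_sub_right (hB.integrable one_le_two), neg_neg]
  have h1 := covariance_eq_sub hA' hB'
  have h2 := covariance_eq_sub hA hB
  simp only [wilsonExpectation]
  rw [← hcov, h2] at h1
  simpa only [Pi.mul_apply] using h1.symm

/-- **The Q-channel bridge.** The crux-format connected correlator of the time-zero plaquette `Q` along the time axis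
on the torus of side `S` equals the sibling crux's axis covariance of plaquette deficits in the plane `(0,1)` displaced
along `e₂` (axis permutation `(0 1 2)` + translation invariance + "deficit and `Re tr` have equal covariance"). -/
theorem latticeConnectedCorr_spatialPlaquette_eq_axisCov (r : LatticeRep G) (β : ℝ) (S : ℕ) [NeZero S] (n : ℕ) :
    latticeConnectedCorr r.ρ β S (spatialPlaquette r) (spatialPlaquette r) n =
      wilsonExpectation (d := 4) (L := S) r.ρ β (fun U =>
          ((r.N : ℝ) - (r.ρ (plaquetteHolonomy U 0 0 1)).trace.re) *
            ((r.N : ℝ) - (r.ρ (plaquetteHolonomy U (Pi.single (2 : Fin 4) ((n : ℕ) : ZMod S)) 0 1)).trace.re)) -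
        wilsonExpectation (d := 4) (L := S) r.ρ β (fun U =>
            (r.N : ℝ) - (r.ρ (plaquetteHolonomy U 0 0 1)).trace.re) *
          wilsonExpectation (d := 4) (L := S) r.ρ β (fun U =>
            (r.N : ℝ) - (r.ρ (plaquetteHolonomy U (Pi.single (2 : Fin 4) ((n : ℕ) : ZMod S)) 0 1)).trace.re) := by
  rw [deficitCov_eq, latticeConnectedCorr_spatialPlaquette_eq]
  -- transport each expectation along the axis permutation
  have hperm : ∀ F : GaugeConfig 4 S G → ℝ,
      wilsonExpectation (d := 4) (L := S) r.ρ β (F ∘ configPerm axisCycle) =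
        wilsonExpectation (d := 4) (L := S) r.ρ β F :=
    fun F => wilsonExpectation_comp_configPerm r.ρ r.continuous β axisCycle F
  have e1 := hperm (fun U => WilsonRP.plaqRe r.ρ U ((0 : Site 4 S), q12) *
    WilsonRP.plaqRe r.ρ U ((Pi.single (0 : Fin 4) ((n : ℕ) : ZMod S) : Site 4 S), q12))
  have e2 := hperm (fun U => WilsonRP.plaqRe r.ρ U ((0 : Site 4 S), q12))
  have e3 := hperm (fun U => WilsonRP.plaqRe r.ρ U ((Pi.single (0 : Fin 4) ((n : ℕ) : ZMod S) : Site 4 S), q12))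
  simp only [Function.comp_def, plaqRe_q12_configPerm, sitePerm_axisCycle_symm_zero,
    sitePerm_axisCycle_symm_single] at e1 e2 e3
  rw [← e1, ← e2, ← e3]

/-- **Clause 1 of the sibling crux in crux format.** Under `CruxCAtWith r a Γ β₀ ℓ₀ c C`, on every femto torus of side `S`
(`β ≥ β₀`, `S · a β ≤ ℓ₀`) and every `1 ≤ n`, `8 n ≤ S`:
`c · Γ(n · a β) ≤ n⁸ ⟨Q ; τ_n Q⟩_{β, S} ≤ C · Γ(n · a β)`. -/
theorem axis_window_of_cruxCAtWith (r : LatticeRep G) {a Γ : ℝ → ℝ} {β₀ ℓ₀ c C : ℝ}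
    (h : CruxCAtWith r a Γ β₀ ℓ₀ c C) (S : ℕ) [NeZero S] {β : ℝ} (hβ : β₀ ≤ β) (hfem : (S : ℝ) * a β ≤ ℓ₀)
    {n : ℕ} (hn1 : 1 ≤ n) (hnS : 8 * n ≤ S) :
    c * Γ ((n : ℝ) * a β) ≤ (n : ℝ) ^ 8 * latticeConnectedCorr r.ρ β S (spatialPlaquette r) (spatialPlaquette r) n ∧
      (n : ℝ) ^ 8 * latticeConnectedCorr r.ρ β S (spatialPlaquette r) (spatialPlaquette r) n ≤ C * Γ ((n : ℝ) * a β) := by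
  have h1 := (h.2.2.2.2.2 S β hβ hfem).1 n hn1 hnS
  rw [latticeConnectedCorr_spatialPlaquette_eq_axisCov]
  exact h1

/-! ## Continuous unit maps take every small value beyond every floor -/

/-- **IVT for the unit map.** A continuous positive `a` with `a → 0` at `+∞` takes every value `s ∈ (0, a B]` at some
`β ≥ B`. -/
theorem exists_ge_unitMap_eq {a : ℝ → ℝ} (ha : Continuous a) (hlim : Tendsto a atTop (𝓝 0))
    (B : ℝ) {s : ℝ} (hs : 0 < s) (hsB : s ≤ a B) : ∃ β : ℝ, B ≤ β ∧ a β = s := by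
  obtain ⟨β', hβ'⟩ := eventually_atTop.1 ((hlim.eventually (gt_mem_nhds hs)).and (eventually_ge_atTop B))
  obtain ⟨hlt, hge⟩ := hβ' β' le_rfl
  obtain ⟨β, hβmem, hβeq⟩ := intermediate_value_Icc' hge ha.continuousOn ⟨hlt.le, hsB⟩
  exact ⟨β, hβmem.1, hβeq⟩

/-- A continuous positive unit map is bounded below on every `[β₀, B]`, so `a β = s` with `s` small forces `β > B`:
concretely, for `s < min over [β₀,B]` … we only need the following form: given `B`, every sufficiently small
positive `s ≤ a B'` for `B' = max B β₀` is attained at some `β ≥ max B β₀`. (Direct corollary of `exists_ge_unitMap_eq`.) -/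
theorem exists_ge_max_unitMap_eq {a : ℝ → ℝ} (ha : Continuous a) (hlim : Tendsto a atTop (𝓝 0))
    (B β₀ : ℝ) {s : ℝ} (hs : 0 < s) (hsB : s ≤ a (max B β₀)) :
    ∃ β : ℝ, B ≤ β ∧ β₀ ≤ β ∧ a β = s := by
  obtain ⟨β, hβ, hβs⟩ := exists_ge_unitMap_eq ha hlim (max B β₀) hs hsB
  exact ⟨β, (le_max_left _ _).trans hβ, (le_max_right _ _).trans hβ, hβs⟩

/-! ## The shape vanishes at `0+` -/

/-- **`Γ(0+) = 0` is forced.** Under `CruxCAtWith r a Γ β₀ ℓ₀ c C` with `a` continuous, `Γ(s) → 0` as `s → 0+`: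
on the fixed torus of side `8` with `n = 1`, freezing gives `⟨Q;τ_1Q⟩_{β,8} → 0` as `β → ∞`, the torus is femto for
all large `β` (`8·a β ≤ ℓ₀`), so `c·Γ(a β) ≤ ⟨Q;τ_1Q⟩_{β,8} → 0`; and by the IVT every small `s > 0` is `a β` for some
large `β`. (Physically: asymptotic freedom — the rescaled curvature two-point function at fixed physical separation
`s → 0` is `≍ g(s)⁴ → 0`; here it is READ OFF the sibling's package, not assumed.) -/
theorem gamma_tendsto_zero_of_cruxCAtWith (r : LatticeRep G) {a Γ : ℝ → ℝ} {β₀ ℓ₀ c C : ℝ}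
    (h : CruxCAtWith r a Γ β₀ ℓ₀ c C) (ha : Continuous a) :
    Tendsto Γ (𝓝[>] 0) (𝓝 0) := by
  have hℓ₀ := h.1
  have hc := h.2.1
  have hapos := h.2.2.1
  have hatend := h.2.2.2.1
  have hΓ := h.2.2.2.2.1
  haveI : NeZero (8 : ℕ) := ⟨by norm_num⟩
  rw [Metric.tendsto_nhdsWithin_nhds]
  intro ε hε
  -- freezing on the torus of side 8, separation 1
  have hfreeze := latticeConnectedCorr_spatialPlaquette_tendsto_zero r 8 1
  have hcε : (0 : ℝ) < c * ε := mul_pos hc hε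
  -- eventually in β: correlator < c ε, the torus is femto, β ≥ β₀
  have hfem_ev : ∀ᶠ β : ℝ in atTop, (8 : ℝ) * a β ≤ ℓ₀ := by
    have h8 : Tendsto (fun β => (8 : ℝ) * a β) atTop (𝓝 0) := by
      simpa using hatend.const_mul (8 : ℝ)
    exact h8.eventually (ge_mem_nhds hℓ₀)
  obtain ⟨B, hB⟩ := eventually_atTop.1 ((hfreeze.eventually (gt_mem_nhds hcε)).and
    (hfem_ev.and (eventually_ge_atTop β₀)))
  refine ⟨min (a B) (ℓ₀ / 8), lt_min (hapos B) (by positivity), fun s hs hsd => ?_⟩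
  rw [Set.mem_Ioi] at hs
  rw [dist_zero_right, Real.norm_eq_abs, abs_of_pos hs] at hsd
  have hsB : s ≤ a B := hsd.le.trans (min_le_left _ _)
  obtain ⟨β, hBβ, hβs⟩ := exists_ge_unitMap_eq ha hatend B hs hsB
  obtain ⟨hcorr, hfem, hβ₀⟩ := hB β hBβ
  have hsℓ : s ≤ ℓ₀ := by
    have h1 := min_le_right (a B) (ℓ₀ / 8)
    linarith
  have hΓpos := (hΓ s hs hsℓ).1
  -- clause 1 at (S, n) = (8, 1)
  have hwin := (axis_window_of_cruxCAtWith r h 8 hβ₀ (by exact_mod_cast hfem) (n := 1) le_rfl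
    (by norm_num)).1
  simp only [Nat.cast_one, one_mul, one_pow] at hwin
  rw [hβs] at hwin
  have hlt : Γ s < ε := by
    have h2 : c * Γ s < c * ε := hwin.trans_lt hcorr
    exact lt_of_mul_lt_mul_left h2 hc.le
  rw [dist_zero_right, Real.norm_eq_abs, abs_of_pos hΓpos]
  exact hlt

end Summit.QuantumFields.YangMills.Theorems.TunedSequenceExists.QFemto

end
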